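import Literature.AlgebraicGeometry.Motives.HodgeStructureHalfTwistAbelianType
import Literature.AlgebraicGeometry.Motives.HodgeStructureCMSesquilinearFormGalois
import Literature.AlgebraicGeometry.Motives.HodgeStructureK3TypeAdjointProofs
import HarnessLib

/-!
# The polarization `Ψ'(v, w) = Ψ(v, αw)` on the half twist (van Geemen 2001, §2.10–§2.11)

[topic AlgebraicGeometry/Motives]

Layer `Literature/AlgebraicGeometry/Motives`, lane `lit-hodgefound` (Track 2 foundations library; prover seat `lit-hodgefound-p26`,
gen 16, row g16-#5). DEFINITIONS WITH BODIES (`EndAction.IsCompatible` — van Geemen's "polarized Hodge structure of CM-type",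
`EndAction.twistForm` — the form `Ψ(v, αw)`, `Polarization.ofEq`, and the two polarizations `EndAction.halfTwistPolarization`,
`EndAction.posHalfTwistPolarization`) + THEOREMS; no named fact (net debt `0`). Sequel of row g16-#4
`Motives/HodgeStructureHalfTwistAbelianType` (whose §4 proves abstract polarizability of the half twists by restriction of the
tensor-product polarization — the first sentence of §2.11; this file is its second, explicit, sentence) and of p02's
`Motives/HodgeStructureHalfTwist` (`A.halfTwist Θ b = V{-b/2}_Θ`).

## The source, verbatim

B. van Geemen, *Half twists of Hodge structures of CM-type*, J. Math. Soc. Japan 53 (2001) 813–833 [vanGeemen2001HalfTwists]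
(held text `paper:arxiv-math_0008076`, p0005). **§2.10 Polarizations.** "A polarization on the Hodge structure `(V, h)` of
weight `k` is a bilinear map `Ψ : V × V → ℚ` satisfying (for all `v, w ∈ V_ℝ`): `Ψ(h(z)v, h(z)w) = (z z̄)^k Ψ(v, w)` and
`Ψ(v, h(i)w)` is a symmetric and positive definite form […] A polarized Hodge structure of CM-type with field `K` is a
polarized Hodge structure `(V, h, ψ)` such that `(V, h, K)` is of CM-type and such that `Ψ(xv, w) = Ψ(v, x̄w)`
(`x ∈ K`, `v, w ∈ V`)." **§2.11 A polarization on the half twist.** "The Hodge structure `K_{-1/2}` has a polarization […]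
If `V` has a polarization, then also `V ⊗ K_{-1/2}` has a polarization (the tensor product polarization) and by restriction
one obtains a polarization on `V_{1/2}`. One can also proceed more explicitly: if `Ψ` is a polarization on `V` then one
chooses an element `α ∈ K` such that `ᾱ = -α` and such that for `σ ∈ Σ` the purely imaginary complex numbers `σ(α)` all
have positive imaginary part. Then the bilinear form `Ψ' : V × V → ℚ`, `Ψ'(v, w) := Ψ(v, αw)` is a polarization on
`V_{1/2}`."

## Sign conventions (read this first)

The tree's `HodgeStructure.Polarization` records the second Hodge–Riemann relation in Deligne's form
"`i^{p-q} Q_ℂ(x, x̄) > 0` on `V^{p,q}`" (`Polarization.pos`), van Geemen in the form "`Ψ(v, h(i)w)` positive definite"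
with `h(z) = z^p z̄^q` on `V^{p,q}`. For `x ∈ V^{p,q}`, `p ≠ q`, and `v = x + x̄` one has `Ψ(v, h(i)v) = 2 i^{q-p} Ψ_ℂ(x, x̄)`
(`Ψ_ℂ(x, x) = 0` by the first relation, `Ψ(x̄, x) = (-1)^{p+q} Ψ(x, x̄)`), so the two positivity conditions agree when
`p - q` is even and are OPPOSITE when `p - q` is odd; a half twist moves every atom `V^{p,q}_σ` to `(p ± 1, q)` or
`(p, q ± 1)`, changing the parity of `p - q`. Consequently, in the tree's convention the element `α` of §2.11 (`ᾱ = -α`,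
`Im σ(α) > 0` for `σ ∈ Σ`) makes `Ψ(v, αw)` a polarization of the NEGATIVE half twist `V_{-1/2} = A.halfTwist Θ 1`
(`EndAction.halfTwistPolarization`), while the POSITIVE half twist `V_{1/2} = A.halfTwist Θ (-1)` of the printed sentence
is polarized by `Ψ(v, αw)` for the opposite sign, `Im σ(α) < 0` on `Σ` — i.e. by `Ψ(v, (-α)w)` for van Geemen's `α`
(`EndAction.posHalfTwistPolarization`). Both elements exist (`exists_skew_im_pos`, `exists_skew_im_neg`, from the tree's
`Deligne1982.SplitCriterion.exists_skew_adapted` = Shimura's `ζ`). Nothing else of the printed statement is changed.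

## What is formalized

* §1 `EndAction.IsCompatible A B` (`B(ι(x)v, w) = B(v, ι(x̄)w)` for all `x ∈ E` — "polarized Hodge structure of CM-type"
  when `B = ψ.form`; the named form of the hypothesis `hses` of the tree's `EndAction.galois_of_sesquilinear`, gen 15), its
  complexification `IsCompatible.baseChange` (= `bilinForm_baseChange_apply_baseChange`), `IsCompatible.galois`
  (= `galois_of_sesquilinear`: `B_ℂ(V_σ, \overline{V_τ}) = 0` for `σ ≠ τ`) and the conjugate-free reading
  `IsCompatible.form_baseChange_eq_zero_of_ne` (`B_ℂ(V_σ, V_τ) = 0` unless `τ = σ̄`).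
* §2 `EndAction.twistForm A B α = B(·, ι(α)·)`: `twistForm_apply`, `twistForm_baseChange`, `IsCompatible.twistForm`
  (**`Ψ'` is again `K`-compatible**, `E` commutative), `twistForm_flip` (`Ψ'` is `(-1)^{n+1}`-symmetric when `ψ`
  polarizes a weight-`n` structure and `ᾱ = -α`).
* §3 Atoms: `twistForm_baseChange_self_conj` (`Ψ'_ℂ(u, ū) = -σ(α) Ψ_ℂ(u, ū)` on `V^{p,q}_σ`),
  `twistForm_baseChange_conj_eq_zero_of_ne` (`Ψ'_ℂ(V_σ, \overline{V_τ}) = 0` for `σ ≠ τ`),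
  `twistForm_baseChange_eigenPiece_eq_zero` and **`twistForm_baseChange_halfTwist_F_eq_zero`** — the FIRST Hodge–Riemann
  relation `Ψ'_ℂ(F^P V{-b/2}, F^{n+b+1-P} V{-b/2}) = 0` for EVERY `b ∈ ℤ` and every `α ∈ E` (only the types and the
  `K`-orthogonality enter).
* §4 **`EndAction.halfTwistPolarization A Θ ψ hc α hα hΘ : Polarization (A.halfTwist Θ 1)`** with
  `form = twistForm ψ.form α` (`hc : IsCompatible`, `hα : ᾱ = -α`, `hΘ : σ ∈ Θ ↔ 0 < Im σ(α)`): **`Ψ'(v, w) = Ψ(v, αw)`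
  POLARIZES `V_{-1/2}`**; `halfTwistPolarization_form`, `isCompatible_halfTwistPolarization`;
  **`EndAction.posHalfTwistPolarization … (hΘ : σ ∈ Θ ↔ Im σ(α) < 0) : Polarization (A.halfTwist Θ (-1))`**, same form —
  **`Ψ(v, αw)` POLARIZES `V_{1/2}`** (through `V{1/2}_Θ = V{-1/2}_{Θ̄}(1)` of row g16-#4 and `Polarization.tateTwist/cast`);
  `exists_skew_im_pos`, `exists_skew_im_neg` (the choice of `α`), and the packaged corollaries
  **`IsCompatible.exists_compatible_polarization_halfTwist_one / _neg_one`**: a polarized Hodge structure of CM-type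
  `(V, ψ, K)` yields polarized Hodge structures of CM-type `(V_{∓1/2}, Ψ', K)`.

SCOPE. `E` a CM field throughout (van Geemen's `K`); `V, E` in arbitrary universes except the existence statements of §4,
which use the tree's `exists_skew_adapted` (`E : Type`). NOT here: §2.11's last sentence (the splitting
`(V_{1/2})_ℝ = ⊕ (V_{1/2})_i` used in van Geemen's verification — the verification here is on eigen-atoms `V^{p,q}_σ` instead),
§3 (Kuga–Satake varieties). -- TODO(general form): none.

## References

* [vanGeemen2001HalfTwists] B. van Geemen, *Half twists of Hodge structures of CM-type*, J. Math. Soc. Japan 53 (2001)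
  813–833: §2.10, §2.11 (p. 5 of `arXiv:math/0008076`), §1.4, §2.6.
* [DeligneHodgeII1971] P. Deligne, *Théorie de Hodge II*, Publ. Math. IHÉS 40 (1971): 2.1.15 (polarizations).
* [Shimura1998] G. Shimura, *Abelian Varieties with Complex Multiplication and Modular Functions*, Princeton (1998): §6.2
  Thm. 3–4 (the element `ζ` with `Im ζ^{φ_i} > 0`).
-/

noncomputable section

open scoped TensorProduct

open Module NumberField

namespace Literature.AlgebraicGeometry.Motives

namespace HodgeStructure

open Literature.NumberTheory.ComplexMultiplication (CMTypeOps.bar CMTypeOps.mem_bar_iff CMTypeOps.conjugate_mem_iff_notMem)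

universe u v

/-- Membership in a `Prop`-guarded supremum `⨆ (_ : c), S`: either `c` holds and `x ∈ S`, or `x = 0`. [folklore] -/
private theorem mem_or_eq_zero_of_mem_iSup_prop_hp {R M : Type*} [Semiring R] [AddCommMonoid M] [Module R M] {c : Prop}
    {S : Submodule R M} {x : M} (hx : x ∈ ⨆ (_ : c), S) : (c ∧ x ∈ S) ∨ x = 0 := by
  by_cases hc : c
  · rw [iSup_pos hc] at hx
    exact Or.inl ⟨hc, hx⟩
  · rw [iSup_neg hc, Submodule.mem_bot] at hx
    exact Or.inr hx

/-- Transport of a polarization along an equality of Hodge structures on the same space and weight. [cite: DeligneHodgeII1971, 2.1.15] -/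
def Polarization.ofEq {V : Type u} [AddCommGroup V] [Module ℚ V] {m : ℤ} {H₁ H₂ : HodgeStructure V m} (h : H₁ = H₂)
    (ψ : Polarization H₁) : Polarization H₂ :=
  h ▸ ψ

/-- `Polarization.ofEq` does not change the form. [cite: DeligneHodgeII1971, 2.1.15] -/
@[simp]
theorem Polarization.ofEq_form {V : Type u} [AddCommGroup V] [Module ℚ V] {m : ℤ} {H₁ H₂ : HodgeStructure V m}
    (h : H₁ = H₂) (ψ : Polarization H₁) : (Polarization.ofEq h ψ).form = ψ.form := by
  subst h
  rfl

/-- From `Im σ(α) < 0` on `Θ` to `Im σ(α) > 0` on `Θ̄`. [cite: vanGeemen2001HalfTwists, §1.3 and §2.11] -/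
theorem mem_bar_iff_im_pos_of_mem_iff_im_neg {E : Type v} [Field E] (Θ : CMType E) {α : E}
    (hΘ : ∀ σ : E →+* ℂ, σ ∈ Θ.1 ↔ (σ α).im < 0) (σ : E →+* ℂ) : σ ∈ (CMTypeOps.bar Θ).1 ↔ 0 < (σ α).im := by
  rw [CMTypeOps.mem_bar_iff]
  constructor
  · intro hσ
    have h1 : ComplexEmbedding.conjugate σ ∈ Θ.1 := (CMTypeOps.conjugate_mem_iff_notMem Θ σ).2 hσ
    have h2 := (hΘ _).1 h1
    rw [ComplexEmbedding.conjugate_coe_eq, Complex.conj_im] at h2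
    linarith
  · intro hpos hσ
    have h := (hΘ σ).1 hσ
    linarith

namespace EndAction

variable {V : Type u} [AddCommGroup V] [Module ℚ V] {n : ℤ} {E : Type v} [Field E] [NumberField E]
  {H : HodgeStructure V n}

/-! ## §1 Polarized Hodge structures of CM-type: `Ψ(xv, w) = Ψ(v, x̄w)` -/

section Compatible

variable [IsCMField E] (A : EndAction H E)

/-- **van Geemen's compatibility `Ψ(xv, w) = Ψ(v, x̄w)`** of a bilinear form `B` on `V` with the action `ι` of the CM
field `E` (`x̄` = `NumberField.IsCMField.complexConj`): "a polarized Hodge structure of CM-type with field `K`" is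
`(H, A, ψ)` with `A.IsCompatible ψ.form`. This NAMES the hypothesis `hses` ("`E`-sesquilinear") of the tree's
`EndAction.galois_of_sesquilinear` / `sesquilinear_iff_galois` (`Motives/HodgeStructureCMSesquilinearFormGalois`, gen 15),
whose conclusions are consumed below by name. [cite: vanGeemen2001HalfTwists, §2.10] -/
def IsCompatible (B : LinearMap.BilinForm ℚ V) : Prop :=
  ∀ (e : E) (v w : V), B (A.ι e v) w = B v (A.ι (IsCMField.complexConj E e) w)

variable {A}

/-- Complexified compatibility: `B_ℂ((ι x)_ℂ u, v) = B_ℂ(u, (ι x̄)_ℂ v)` (the tree's `bilinForm_baseChange_apply_baseChange`).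
[cite: vanGeemen2001HalfTwists, §2.10] -/
theorem IsCompatible.baseChange {B : LinearMap.BilinForm ℚ V} (hc : A.IsCompatible B) (e : E) (x y : ℂ ⊗[ℚ] V) :
    B.baseChange ℂ ((A.ι e).baseChange ℂ x) y = B.baseChange ℂ x ((A.ι (IsCMField.complexConj E e)).baseChange ℂ y) :=
  bilinForm_baseChange_apply_baseChange B _ _ (hc e) x y

/-- **A compatible form is a Galois form: `B_ℂ(V_σ, \overline{V_τ}) = 0` for `σ ≠ τ`** — the tree's
`EndAction.galois_of_sesquilinear` under its name here. [cite: vanGeemen2001HalfTwists, §2.10–§2.11] [cite: GreenGriffithsKerr2012, §V.D pp. 162–163] -/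
theorem IsCompatible.galois {B : LinearMap.BilinForm ℚ V} (hc : A.IsCompatible B) :
    ∀ ⦃σ τ : E →+* ℂ⦄, σ ≠ τ → ∀ ⦃x y : ℂ ⊗[ℚ] V⦄,
      x ∈ (⨅ e, Module.End.eigenspace ((A.ι e).baseChange ℂ) (σ e)) →
      y ∈ (⨅ e, Module.End.eigenspace ((A.ι e).baseChange ℂ) (τ e)) → B.baseChange ℂ x (conj y) = 0 :=
  A.galois_of_sesquilinear B hc

/-- **`K`-orthogonality without the conjugate: `B_ℂ(V_σ, V_τ) = 0` unless `τ = σ̄`** for joint eigenvectors `u ∈ V_σ`,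
`v ∈ V_τ` (apply `IsCompatible.galois` to `σ ≠ τ̄` and `v̄ ∈ V_{τ̄}`).
[cite: vanGeemen2001HalfTwists, §2.10–§2.11 ("it is convenient to split (V_{1/2})_ℝ = ⊕ (V_{1/2})_i")] -/
theorem IsCompatible.form_baseChange_eq_zero_of_ne {B : LinearMap.BilinForm ℚ V} (hc : A.IsCompatible B)
    {σ τ : E →+* ℂ} (hστ : τ ≠ ComplexEmbedding.conjugate σ) {x y : ℂ ⊗[ℚ] V}
    (hx : ∀ e : E, (A.ι e).baseChange ℂ x = σ e • x) (hy : ∀ e : E, (A.ι e).baseChange ℂ y = τ e • y) :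
    B.baseChange ℂ x y = 0 := by
  have hcy : ∀ e : E, (A.ι e).baseChange ℂ (conj y) = ComplexEmbedding.conjugate τ e • conj y := fun e => by
    rw [← conj_baseChange, hy e, conj_smul, ComplexEmbedding.conjugate_coe_eq]
  have hne : σ ≠ ComplexEmbedding.conjugate τ := fun h' =>
    hστ (by rw [h', ComplexEmbedding.involutive_conjugate E τ])
  have h := hc.galois hne ((A.mem_iInf_eigenspace_iff σ x).2 hx)
    ((A.mem_iInf_eigenspace_iff (ComplexEmbedding.conjugate τ) (conj y)).2 hcy)
  rwa [conj_conj] at h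

end Compatible

/-! ## §2 The twisted form `Ψ'(v, w) = Ψ(v, αw)` -/

section TwistForm

variable (A : EndAction H E)

/-- **`Ψ'(v, w) := Ψ(v, αw)`** for `α ∈ E`. [cite: vanGeemen2001HalfTwists, §2.11] -/
def twistForm (B : LinearMap.BilinForm ℚ V) (α : E) : LinearMap.BilinForm ℚ V :=
  B.compl₂ (A.ι α : V →ₗ[ℚ] V)

/-- `Ψ'(v, w) = Ψ(v, αw)`. [cite: vanGeemen2001HalfTwists, §2.11] -/
@[simp]
theorem twistForm_apply (B : LinearMap.BilinForm ℚ V) (α : E) (v w : V) : A.twistForm B α v w = B v (A.ι α w) :=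
  rfl

/-- Complexification: `Ψ'_ℂ(x, y) = Ψ_ℂ(x, (ι α)_ℂ y)`. [cite: vanGeemen2001HalfTwists, §2.11] -/
theorem twistForm_baseChange (B : LinearMap.BilinForm ℚ V) (α : E) (x y : ℂ ⊗[ℚ] V) :
    (A.twistForm B α).baseChange ℂ x y = B.baseChange ℂ x ((A.ι α).baseChange ℂ y) := by
  induction x using TensorProduct.induction_on with
  | zero => simp
  | tmul a v =>
    induction y using TensorProduct.induction_on with
    | zero => simp
    | tmul b w => simp [LinearMap.BilinForm.baseChange_tmul, LinearMap.baseChange_tmul]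
    | add y₁ y₂ h₁ h₂ => simp only [map_add, h₁, h₂]
  | add x₁ x₂ h₁ h₂ => simp only [map_add, LinearMap.add_apply, h₁, h₂]

variable {A} [IsCMField E]

/-- **`Ψ'` is again `K`-compatible**: `Ψ'(xv, w) = Ψ(xv, αw) = Ψ(v, x̄αw) = Ψ(v, αx̄w) = Ψ'(v, x̄w)` (`E` is commutative).
[cite: vanGeemen2001HalfTwists, §2.10–§2.11] -/
theorem IsCompatible.twistForm {B : LinearMap.BilinForm ℚ V} (hc : A.IsCompatible B) (α : E) :
    A.IsCompatible (A.twistForm B α) := by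
  intro e v w
  rw [twistForm_apply, twistForm_apply, hc e, ← Module.End.mul_apply, ← map_mul, mul_comm, map_mul,
    Module.End.mul_apply]

/-- **`Ψ'` is `(-1)^{n+1}`-symmetric when `Ψ` polarizes a weight-`n` structure and `ᾱ = -α`**:
`Ψ'(w, v) = Ψ(w, αv) = (-1)^n Ψ(αv, w) = (-1)^n Ψ(v, ᾱw) = (-1)^{n+1} Ψ'(v, w)` (so the weight parity flips, as it must for
`V_{∓1/2}`). [cite: vanGeemen2001HalfTwists, §2.11] -/
theorem twistForm_flip (ψ : Polarization H) (hc : A.IsCompatible ψ.form) {α : E} (hα : IsCMField.complexConj E α = -α) :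
    (A.twistForm ψ.form α).flip = (((n + 1).negOnePow : ℤˣ) : ℤ) • A.twistForm ψ.form α := by
  refine LinearMap.ext fun v => LinearMap.ext fun w => ?_
  show ψ.form w (A.ι α v) = (((n + 1).negOnePow : ℤˣ) : ℤ) • ψ.form v (A.ι α w)
  rw [ψ.form_swap, hc α v w, hα, map_neg, LinearMap.neg_apply, map_neg, Int.negOnePow_succ, Units.val_neg, zsmul_eq_mul,
    Int.cast_neg]
  ring

end TwistForm

/-! ## §3 The twisted form on the eigen-atoms `V^{p,q}_σ` and the first Hodge–Riemann relation -/

section Atoms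

variable [IsCMField E] (A : EndAction H E)

/-- **`Ψ'_ℂ(u, ū) = -σ(α) · Ψ_ℂ(u, ū)` for `u ∈ V^{p,q}_σ`** (`ū ∈ V^{q,p}_{σ̄}` and `σ̄(α) = \overline{σ(α)} = σ(ᾱ) = -σ(α)`).
[cite: vanGeemen2001HalfTwists, §2.11] -/
theorem twistForm_baseChange_self_conj (B : LinearMap.BilinForm ℚ V) {α : E} (hα : IsCMField.complexConj E α = -α)
    {σ : E →+* ℂ} {p q : ℤ} {u : ℂ ⊗[ℚ] V} (hu : u ∈ A.eigenPiece σ p q) :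
    (A.twistForm B α).baseChange ℂ u (conj u) = -(σ α) * B.baseChange ℂ u (conj u) := by
  rw [twistForm_baseChange]
  have hcu : conj u ∈ A.eigenPiece (ComplexEmbedding.conjugate σ) q p := by
    rw [← complexConj_eigenPiece_holds A σ p q, mem_complexConj, conj_conj]
    exact hu
  obtain ⟨-, hce⟩ := (A.mem_eigenPiece_iff _ _ _ _).1 hcu
  rw [hce α, map_smul, smul_eq_mul, ComplexEmbedding.conjugate_coe_eq, ← IsCMField.complexEmbedding_complexConj, hα,
    map_neg]

variable {A}

/-- **`Ψ'_ℂ(V_σ, \overline{V_τ}) = 0` for `σ ≠ τ`** (`\overline{V_τ} = V_{τ̄}` and `K`-orthogonality).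
[cite: vanGeemen2001HalfTwists, §2.11] -/
theorem twistForm_baseChange_conj_eq_zero_of_ne {B : LinearMap.BilinForm ℚ V} (hc : A.IsCompatible B) (α : E)
    {σ τ : E →+* ℂ} (hστ : σ ≠ τ) {p q p' q' : ℤ} {u v : ℂ ⊗[ℚ] V} (hu : u ∈ A.eigenPiece σ p q)
    (hv : v ∈ A.eigenPiece τ p' q') : (A.twistForm B α).baseChange ℂ u (conj v) = 0 := by
  rw [twistForm_baseChange]
  have hcv : conj v ∈ A.eigenPiece (ComplexEmbedding.conjugate τ) q' p' := by
    rw [← complexConj_eigenPiece_holds A τ p' q', mem_complexConj, conj_conj]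
    exact hv
  obtain ⟨-, hcve⟩ := (A.mem_eigenPiece_iff _ _ _ _).1 hcv
  obtain ⟨-, hue⟩ := (A.mem_eigenPiece_iff _ _ _ _).1 hu
  obtain ⟨-, hve⟩ := (A.mem_eigenPiece_iff _ _ _ _).1 hv
  rw [hcve α, map_smul, smul_eq_mul]
  suffices h0 : B.baseChange ℂ u (conj v) = 0 by rw [h0, mul_zero]
  exact hc.galois hστ ((A.mem_iInf_eigenspace_iff σ u).2 hue) ((A.mem_iInf_eigenspace_iff τ v).2 hve)

/-- **Two atoms pair to zero under `Ψ'_ℂ` unless their twist degrees are complementary**: for `x ∈ V^{p,n-p}_σ`,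
`y ∈ V^{p',n-p'}_τ`, `Ψ'_ℂ(x, y) = τ(α) Ψ_ℂ(x, y)` vanishes unless `p + p' = n` (first Hodge–Riemann relation of `Ψ`) and
`τ = σ̄` (`K`-orthogonality), in which case the `{-b/2}_Θ`-degrees of the two atoms add up to `n + b`
(`twistDegree_conjugate`). [cite: vanGeemen2001HalfTwists, §2.11] -/
theorem twistForm_baseChange_eigenPiece_eq_zero (ψ : Polarization H) (hc : A.IsCompatible ψ.form) (α : E) (Θ : CMType E)
    (b : ℤ) {a a' : (E →+* ℂ) × ℤ} (h : twistDegree Θ.1 b a + twistDegree Θ.1 b a' ≠ n + b) {x y : ℂ ⊗[ℚ] V}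
    (hx : x ∈ A.eigenPiece a.1 a.2 (n - a.2)) (hy : y ∈ A.eigenPiece a'.1 a'.2 (n - a'.2)) :
    (A.twistForm ψ.form α).baseChange ℂ x y = 0 := by
  rw [twistForm_baseChange]
  obtain ⟨hxp, hxe⟩ := (A.mem_eigenPiece_iff _ _ _ x).1 hx
  obtain ⟨hyp, hye⟩ := (A.mem_eigenPiece_iff _ _ _ y).1 hy
  rw [hye α, map_smul, smul_eq_mul]
  suffices h0 : ψ.form.baseChange ℂ x y = 0 by rw [h0, mul_zero]
  by_cases hpp : a.2 + a'.2 = n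
  · by_cases hστ : a'.1 = ComplexEmbedding.conjugate a.1
    · exfalso
      apply h
      have ha' : a' = (ComplexEmbedding.conjugate a.1, n - a.2) := Prod.ext hστ (by simp only; omega)
      rw [ha', twistDegree_conjugate]
      ring
    · exact hc.form_baseChange_eq_zero_of_ne hστ hxe hye
  · exact ψ.form_piece_piece hpp hxp hyp

/-- **FIRST HODGE–RIEMANN RELATION FOR `Ψ'` ON `V{-b/2}_Θ`: `Ψ'_ℂ(F^P, F^{n+b+1-P}) = 0`** (every `b ∈ ℤ`, every `α`):
both filtration steps are sums of atoms (`halfTwist_F`, `halfTwistPiece_eq_biSup`), and a pair of atoms of degrees `≥ P` and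
`≥ n+b+1-P` never has complementary degrees. [cite: vanGeemen2001HalfTwists, §2.11] [cite: DeligneHodgeII1971, 2.1.15] -/
theorem twistForm_baseChange_halfTwist_F_eq_zero (ψ : Polarization H) (hc : A.IsCompatible ψ.form) (α : E) (Θ : CMType E)
    (b P : ℤ) {x y : ℂ ⊗[ℚ] V} (hx : x ∈ (A.halfTwist Θ b).F P) (hy : y ∈ (A.halfTwist Θ b).F (n + b + 1 - P)) :
    (A.twistForm ψ.form α).baseChange ℂ x y = 0 := by
  rw [halfTwist_F] at hx hy
  refine Submodule.iSup_induction (p := fun P' : ℤ => ⨆ (_ : P ≤ P'), A.halfTwistPiece Θ b P' (n + b - P'))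
    (motive := fun x => (A.twistForm ψ.form α).baseChange ℂ x y = 0) hx ?_ (by simp)
    (fun x₁ x₂ h₁ h₂ => by simp only [map_add, LinearMap.add_apply, h₁, h₂, add_zero])
  intro P₁ x hx
  rcases mem_or_eq_zero_of_mem_iSup_prop_hp hx with ⟨hP₁, hx⟩ | rfl
  · rw [halfTwistPiece_eq_biSup] at hx
    refine Submodule.iSup_induction
      (p := fun a : (E →+* ℂ) × ℤ => ⨆ (_ : twistDegree Θ.1 b a = P₁), A.eigenPiece a.1 a.2 (n - a.2))
      (motive := fun x => (A.twistForm ψ.form α).baseChange ℂ x y = 0) hx ?_ (by simp)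
      (fun x₁ x₂ h₁ h₂ => by simp only [map_add, LinearMap.add_apply, h₁, h₂, add_zero])
    intro a x hx
    rcases mem_or_eq_zero_of_mem_iSup_prop_hp hx with ⟨ha, hx⟩ | rfl
    · refine Submodule.iSup_induction
        (p := fun P' : ℤ => ⨆ (_ : n + b + 1 - P ≤ P'), A.halfTwistPiece Θ b P' (n + b - P'))
        (motive := fun y => (A.twistForm ψ.form α).baseChange ℂ x y = 0) hy ?_ (by simp)
        (fun y₁ y₂ h₁ h₂ => by simp only [map_add, h₁, h₂, add_zero])
      intro P₂ y hy
      rcases mem_or_eq_zero_of_mem_iSup_prop_hp hy with ⟨hP₂, hy⟩ | rfl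
      · rw [halfTwistPiece_eq_biSup] at hy
        refine Submodule.iSup_induction
          (p := fun a' : (E →+* ℂ) × ℤ => ⨆ (_ : twistDegree Θ.1 b a' = P₂), A.eigenPiece a'.1 a'.2 (n - a'.2))
          (motive := fun y => (A.twistForm ψ.form α).baseChange ℂ x y = 0) hy ?_ (by simp)
          (fun y₁ y₂ h₁ h₂ => by simp only [map_add, h₁, h₂, add_zero])
        intro a' y hy
        rcases mem_or_eq_zero_of_mem_iSup_prop_hp hy with ⟨ha', hy⟩ | rfl
        · exact twistForm_baseChange_eigenPiece_eq_zero ψ hc α Θ b (by rw [ha, ha']; omega) hx hy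
        · simp
      · simp
    · simp
  · simp

end Atoms

/-! ## §4 `Ψ'(v, w) = Ψ(v, αw)` polarizes the half twists -/

section Main

variable [IsCMField E] (A : EndAction H E) (Θ : CMType E) (ψ : Polarization H)

/-- **VAN GEEMEN §2.11 (tree sign convention): `Ψ'(v, w) := Ψ(v, αw)` IS A POLARIZATION OF THE NEGATIVE HALF TWIST
`V_{-1/2} = V{-1/2}_Θ`** for a polarized Hodge structure of CM-type `(V, ψ, K)` and `α ∈ K` with `ᾱ = -α`, `Im σ(α) > 0`
exactly for `σ ∈ Θ`. Weight `n + 1`; `(-1)^{n+1}`-symmetry by `twistForm_flip`; HR-I by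
`twistForm_baseChange_halfTwist_F_eq_zero`; HR-II atom by atom: on `x = Σ_σ x_σ ∈ V{-1/2}^{P,Q} = V_+^{P-1,Q} ⊕ V_-^{P,Q-1}`
the cross terms vanish (`twistForm_baseChange_conj_eq_zero_of_ne`) and `i^{P-Q} Ψ'_ℂ(x_σ, x̄_σ) = Im σ(α) · i^{(P-1)-Q}
Ψ_ℂ(x_σ, x̄_σ) > 0` for `σ ∈ Θ`, `= (-Im σ(α)) · i^{P-(Q-1)} Ψ_ℂ(x_σ, x̄_σ) > 0` for `σ ∉ Θ`. See the module docstring for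
the sign convention relative to the printed sentence. [cite: vanGeemen2001HalfTwists, §2.11] [cite: DeligneHodgeII1971, 2.1.15] -/
def halfTwistPolarization (hc : A.IsCompatible ψ.form) (α : E) (hα : IsCMField.complexConj E α = -α)
    (hΘ : ∀ σ : E →+* ℂ, σ ∈ Θ.1 ↔ 0 < (σ α).im) : Polarization (A.halfTwist Θ 1) where
  form := A.twistForm ψ.form α
  flip_form := twistForm_flip ψ hc hα
  form_apply_eq_zero P x hx y hy := twistForm_baseChange_halfTwist_F_eq_zero ψ hc α Θ 1 P hx hy
  pos P Q hPQ x hx hx0 := by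
    classical
    rw [A.halfTwist_piece Θ 1 hPQ] at hx
    -- the atoms of `V{-1/2}^{P,Q} = V_+^{P-1,Q} ⊕ V_-^{P,Q-1}`, indexed by the embedding
    set At : (E →+* ℂ) → Submodule ℂ (ℂ ⊗[ℚ] V) := fun σ =>
      if σ ∈ Θ.1 then A.eigenPiece σ (P - 1) Q else A.eigenPiece σ P (Q - 1) with hAt
    have hle : A.halfTwistPiece Θ 1 P Q ≤ ⨆ σ ∈ (Finset.univ : Finset (E →+* ℂ)), At σ := by
      refine sup_le (iSup₂_le fun σ hσ => ?_) (iSup₂_le fun σ hσ => ?_)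
      · refine le_trans (le_of_eq ?_) (le_iSup₂_of_le (f := fun σ (_ : σ ∈ (Finset.univ : Finset (E →+* ℂ))) => At σ)
          σ (Finset.mem_univ σ) le_rfl)
        simp only [hAt, if_pos hσ]
      · refine le_trans (le_of_eq ?_) (le_iSup₂_of_le (f := fun σ (_ : σ ∈ (Finset.univ : Finset (E →+* ℂ))) => At σ)
          σ (Finset.mem_univ σ) le_rfl)
        simp only [hAt, if_neg hσ]
    obtain ⟨μ, hμ⟩ := (Submodule.mem_iSup_finset_iff_exists_sum _ _).1 (hle hx)
    -- every `μ σ` is a `σ`-atom of some Hodge type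
    have hat : ∀ σ, ∃ p₀ q₀ : ℤ, (μ σ : ℂ ⊗[ℚ] V) ∈ A.eigenPiece σ p₀ q₀ := fun σ => by
      by_cases hσ : σ ∈ Θ.1
      · exact ⟨P - 1, Q, by simpa only [hAt, if_pos hσ] using (μ σ).2⟩
      · exact ⟨P, Q - 1, by simpa only [hAt, if_neg hσ] using (μ σ).2⟩
    -- the diagonal terms are non-negative reals, positive on non-zero atoms
    have hd : ∀ σ, ∃ r : ℝ, 0 ≤ r ∧ ((μ σ : ℂ ⊗[ℚ] V) ≠ 0 → 0 < r) ∧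
        Complex.I ^ P * (Complex.I ^ Q)⁻¹ * (A.twistForm ψ.form α).baseChange ℂ (μ σ) (conj (μ σ : ℂ ⊗[ℚ] V)) = r := by
      intro σ
      have hσα : starRingEnd ℂ (σ α) = -(σ α) := by rw [← IsCMField.complexEmbedding_complexConj, hα, map_neg]
      have hre : (σ α).re = 0 := by
        have h := congrArg Complex.re hσα
        simp only [Complex.conj_re, Complex.neg_re] at h
        linarith
      set t : ℝ := (σ α).im with ht_def
      have hIα : σ α = (t : ℂ) * Complex.I := by
        apply Complex.ext <;> simp [hre, ht_def]
      by_cases hu0 : (μ σ : ℂ ⊗[ℚ] V) = 0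
      · refine ⟨0, le_rfl, fun h => (h hu0).elim, ?_⟩
        rw [hu0]
        simp
      by_cases hσ : σ ∈ Θ.1
      · have hu : (μ σ : ℂ ⊗[ℚ] V) ∈ A.eigenPiece σ (P - 1) Q := by simpa only [hAt, if_pos hσ] using (μ σ).2
        obtain ⟨r, hr, hψ⟩ := ψ.pos (P - 1) Q (by omega) _ (A.eigenPiece_le_piece σ _ _ hu) hu0
        have ht : 0 < t := (hΘ σ).1 hσ
        refine ⟨t * r, (mul_pos ht hr).le, fun _ => mul_pos ht hr, ?_⟩
        rw [A.twistForm_baseChange_self_conj ψ.form hα hu, Complex.ofReal_mul, ← hψ,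
          zpow_sub_one₀ Complex.I_ne_zero, Complex.inv_I]
        rw [hIα]
        ring
      · have hu : (μ σ : ℂ ⊗[ℚ] V) ∈ A.eigenPiece σ P (Q - 1) := by simpa only [hAt, if_neg hσ] using (μ σ).2
        obtain ⟨r, hr, hψ⟩ := ψ.pos P (Q - 1) (by omega) _ (A.eigenPiece_le_piece σ _ _ hu) hu0
        have ht : t < 0 := by
          have h1 : ComplexEmbedding.conjugate σ ∈ Θ.1 := (CMTypeOps.conjugate_mem_iff_notMem Θ σ).2 hσ
          have h2 := (hΘ _).1 h1
          rw [ComplexEmbedding.conjugate_coe_eq, Complex.conj_im] at h2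
          linarith
        refine ⟨-t * r, (mul_pos (neg_pos.2 ht) hr).le, fun _ => mul_pos (neg_pos.2 ht) hr, ?_⟩
        rw [A.twistForm_baseChange_self_conj ψ.form hα hu, Complex.ofReal_mul, Complex.ofReal_neg, ← hψ,
          zpow_sub_one₀ Complex.I_ne_zero, mul_inv, inv_inv]
        rw [hIα]
        ring
    choose r hr0 hrpos hr using hd
    have hne : ∃ σ, (μ σ : ℂ ⊗[ℚ] V) ≠ 0 := by
      by_contra h
      apply hx0
      rw [← hμ]
      exact Finset.sum_eq_zero fun σ _ => not_not.1 (not_exists.1 h σ)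
    obtain ⟨σ₀, hσ₀⟩ := hne
    refine ⟨∑ σ, r σ, Finset.sum_pos' (fun σ _ => hr0 σ) ⟨σ₀, Finset.mem_univ _, hrpos σ₀ hσ₀⟩, ?_⟩
    rw [← hμ, map_sum (conj : ℂ ⊗[ℚ] V →ₗ[ℚ] ℂ ⊗[ℚ] V),
      map_sum ((A.twistForm ψ.form α).baseChange ℂ) (fun i => (μ i : ℂ ⊗[ℚ] V)) Finset.univ, LinearMap.sum_apply,
      Finset.mul_sum, Complex.ofReal_sum]
    refine Finset.sum_congr rfl fun σ _ => ?_
    rw [map_sum ((A.twistForm ψ.form α).baseChange ℂ (μ σ : ℂ ⊗[ℚ] V)), Finset.sum_eq_single σ, hr σ]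
    · intro τ _ hτσ
      obtain ⟨p₀, q₀, hu⟩ := hat σ
      obtain ⟨p₁, q₁, hv⟩ := hat τ
      exact twistForm_baseChange_conj_eq_zero_of_ne hc α (Ne.symm hτσ) hu hv
    · intro h
      exact (h (Finset.mem_univ σ)).elim

/-- The form of `halfTwistPolarization` is `Ψ'(v, w) = Ψ(v, αw)`. [cite: vanGeemen2001HalfTwists, §2.11] -/
@[simp]
theorem halfTwistPolarization_form (hc : A.IsCompatible ψ.form) (α : E) (hα : IsCMField.complexConj E α = -α)
    (hΘ : ∀ σ : E →+* ℂ, σ ∈ Θ.1 ↔ 0 < (σ α).im) :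
    (A.halfTwistPolarization Θ ψ hc α hα hΘ).form = A.twistForm ψ.form α := rfl

/-- Pointwise: `(halfTwistPolarization …).form v w = ψ(v, αw)`. [cite: vanGeemen2001HalfTwists, §2.11] -/
theorem halfTwistPolarization_form_apply (hc : A.IsCompatible ψ.form) (α : E) (hα : IsCMField.complexConj E α = -α)
    (hΘ : ∀ σ : E →+* ℂ, σ ∈ Θ.1 ↔ 0 < (σ α).im) (v w : V) :
    (A.halfTwistPolarization Θ ψ hc α hα hΘ).form v w = ψ.form v (A.ι α w) := rfl

/-- **`(V_{-1/2}, Ψ', K)` is again a polarized Hodge structure of CM-type** (for the twisted action, same `ι`).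
[cite: vanGeemen2001HalfTwists, §2.10–§2.11] -/
theorem isCompatible_halfTwistPolarization (hc : A.IsCompatible ψ.form) (α : E) (hα : IsCMField.complexConj E α = -α)
    (hΘ : ∀ σ : E →+* ℂ, σ ∈ Θ.1 ↔ 0 < (σ α).im) :
    (A.halfTwistAction Θ 1).IsCompatible (A.halfTwistPolarization Θ ψ hc α hα hΘ).form :=
  hc.twistForm α

/-- **VAN GEEMEN §2.11 FOR THE POSITIVE HALF TWIST: `Ψ'(v, w) = Ψ(v, αw)` IS A POLARIZATION OF `V_{1/2} = V{1/2}_Θ`**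
when `ᾱ = -α` and `Im σ(α) < 0` for `σ ∈ Θ` (tree sign convention; the printed "positive imaginary part" is van Geemen's
convention — module docstring). Obtained from `halfTwistPolarization` for the conjugate type through
`V{1/2}_Θ = V{-1/2}_{Θ̄}(1)` (row g16-#4 `halfTwist_neg_eq_cast`) and `Polarization.tateTwist` / `.cast` (same form).
[cite: vanGeemen2001HalfTwists, §2.11 and §2.6] [cite: DeligneHodgeII1971, 2.1.15] -/
def posHalfTwistPolarization (hc : A.IsCompatible ψ.form) (α : E) (hα : IsCMField.complexConj E α = -α)
    (hΘ : ∀ σ : E →+* ℂ, σ ∈ Θ.1 ↔ (σ α).im < 0) : Polarization (A.halfTwist Θ (-1)) :=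
  Polarization.ofEq (A.halfTwist_neg_eq_cast Θ 1).symm
    (((A.halfTwistPolarization (CMTypeOps.bar Θ) ψ hc α hα (mem_bar_iff_im_pos_of_mem_iff_im_neg Θ hΘ)).tateTwist 1).cast
      _)

/-- The form of `posHalfTwistPolarization` is `Ψ'(v, w) = Ψ(v, αw)`. [cite: vanGeemen2001HalfTwists, §2.11] -/
@[simp]
theorem posHalfTwistPolarization_form (hc : A.IsCompatible ψ.form) (α : E) (hα : IsCMField.complexConj E α = -α)
    (hΘ : ∀ σ : E →+* ℂ, σ ∈ Θ.1 ↔ (σ α).im < 0) :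
    (A.posHalfTwistPolarization Θ ψ hc α hα hΘ).form = A.twistForm ψ.form α := by
  rw [posHalfTwistPolarization, Polarization.ofEq_form]
  rfl

/-- **`(V_{1/2}, Ψ', K)` is again a polarized Hodge structure of CM-type.** [cite: vanGeemen2001HalfTwists, §2.10–§2.11] -/
theorem isCompatible_posHalfTwistPolarization (hc : A.IsCompatible ψ.form) (α : E)
    (hα : IsCMField.complexConj E α = -α) (hΘ : ∀ σ : E →+* ℂ, σ ∈ Θ.1 ↔ (σ α).im < 0) :
    (A.halfTwistAction Θ (-1)).IsCompatible (A.posHalfTwistPolarization Θ ψ hc α hα hΘ).form := by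
  rw [posHalfTwistPolarization_form]
  exact hc.twistForm α

end Main

/-! ### The choice of `α` and the packaged statements -/

section Existence

variable {V : Type u} [AddCommGroup V] [Module ℚ V] {n : ℤ} {E : Type} [Field E] [NumberField E] [IsCMField E]
  {H : HodgeStructure V n} (A : EndAction H E) (Θ : CMType E)

/-- **"one chooses an element `α ∈ K` such that `ᾱ = -α` and such that for `σ ∈ Σ` the purely imaginary complex numbers
`σ(α)` all have positive imaginary part"** — such `α` exists (Shimura's `ζ`; the tree's `exists_skew_adapted`).
[cite: vanGeemen2001HalfTwists, §2.11] [cite: Shimura1998, §6.2 Thm. 3–4] -/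
theorem exists_skew_im_pos : ∃ α : E, IsCMField.complexConj E α = -α ∧ ∀ σ : E →+* ℂ, σ ∈ Θ.1 ↔ 0 < (σ α).im := by
  obtain ⟨ζ, h1, -, h3⟩ := Deligne1982.SplitCriterion.exists_skew_adapted Θ
  exact ⟨ζ, h1, h3⟩

/-- The opposite choice: `ᾱ = -α` with `Im σ(α) < 0` exactly on `Θ` (`α := -ζ`). [cite: vanGeemen2001HalfTwists, §2.11] [cite: Shimura1998, §6.2 Thm. 3–4] -/
theorem exists_skew_im_neg : ∃ α : E, IsCMField.complexConj E α = -α ∧ ∀ σ : E →+* ℂ, σ ∈ Θ.1 ↔ (σ α).im < 0 := by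
  obtain ⟨ζ, h1, -, h3⟩ := Deligne1982.SplitCriterion.exists_skew_adapted Θ
  refine ⟨-ζ, by rw [map_neg, h1, neg_neg], fun σ => ?_⟩
  rw [map_neg, Complex.neg_im, neg_lt_zero]
  exact h3 σ

variable {A}

/-- **A polarized Hodge structure of CM-type `(V, ψ, K)` makes `V_{-1/2}` a polarized Hodge structure of CM-type** (with
`Ψ'(v, w) = Ψ(v, αw)` for a suitable `α`). [cite: vanGeemen2001HalfTwists, §2.11] -/
theorem IsCompatible.exists_compatible_polarization_halfTwist_one {ψ : Polarization H} (hc : A.IsCompatible ψ.form) :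
    ∃ ψ' : Polarization (A.halfTwist Θ 1), (A.halfTwistAction Θ 1).IsCompatible ψ'.form ∧
      ∃ α : E, IsCMField.complexConj E α = -α ∧ ∀ v w, ψ'.form v w = ψ.form v (A.ι α w) := by
  obtain ⟨α, hα, hΘ⟩ := exists_skew_im_pos Θ
  exact ⟨A.halfTwistPolarization Θ ψ hc α hα hΘ, A.isCompatible_halfTwistPolarization Θ ψ hc α hα hΘ, α, hα,
    fun v w => rfl⟩

/-- **A polarized Hodge structure of CM-type `(V, ψ, K)` makes `V_{1/2}` a polarized Hodge structure of CM-type** (with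
`Ψ'(v, w) = Ψ(v, αw)` for a suitable `α`) — the printed conclusion of §2.11. [cite: vanGeemen2001HalfTwists, §2.11] -/
theorem IsCompatible.exists_compatible_polarization_halfTwist_neg_one {ψ : Polarization H} (hc : A.IsCompatible ψ.form) :
    ∃ ψ' : Polarization (A.halfTwist Θ (-1)), (A.halfTwistAction Θ (-1)).IsCompatible ψ'.form ∧
      ∃ α : E, IsCMField.complexConj E α = -α ∧ ∀ v w, ψ'.form v w = ψ.form v (A.ι α w) := by
  obtain ⟨α, hα, hΘ⟩ := exists_skew_im_neg Θ
  refine ⟨A.posHalfTwistPolarization Θ ψ hc α hα hΘ, A.isCompatible_posHalfTwistPolarization Θ ψ hc α hα hΘ, α, hα,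
    fun v w => ?_⟩
  rw [posHalfTwistPolarization_form, twistForm_apply]

/-- In particular the half twists of a polarized Hodge structure of CM-type are polarizable (cf. row g16-#4's
`IsPolarizable.halfTwist`, which needs no compatibility). [cite: vanGeemen2001HalfTwists, §2.11] -/
theorem IsCompatible.isPolarizable_halfTwist_one {ψ : Polarization H} (hc : A.IsCompatible ψ.form) :
    (A.halfTwist Θ 1).IsPolarizable :=
  let ⟨ψ', _⟩ := hc.exists_compatible_polarization_halfTwist_one Θ
  ⟨ψ'⟩

/-- … and so is `V_{1/2}`. [cite: vanGeemen2001HalfTwists, §2.11] -/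
theorem IsCompatible.isPolarizable_halfTwist_neg_one {ψ : Polarization H} (hc : A.IsCompatible ψ.form) :
    (A.halfTwist Θ (-1)).IsPolarizable :=
  let ⟨ψ', _⟩ := hc.exists_compatible_polarization_halfTwist_neg_one Θ
  ⟨ψ'⟩

end Existence

end EndAction

end HodgeStructure

end Literature.AlgebraicGeometry.Motives
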